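/-
Origin: expansion seat `planner-pub-hodgecm-mc-axioms-1-g14-0`, handover #W11 2026-08-20T15:53:55Z md5 e80416996276 (PKG 64e7f39e2fae → e80416996276; 421 l.; MECHANICAL (iib-R) rewrite v3.1 of the PKG file as it stands (28 token edits; rules R1x1+RX[h₂']x27)) (`HOME/mc/pub-hodgecm-mc-axioms-1-g14/revendor/kit-r55/stage55/HodgeCM/Model/ArchKTypeOfSlotChar34.lean`, md5 e80416996276, 421 lines);
landed by the gen-22 packager (p-g22) in gate run 55 REPLACES the earlier landed copy of `HodgeCM/Model/ArchKTypeOfSlotChar34.lean` (seat copy carried the packager Origin header of an earlier run (stripped)).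
-/
/-
Copyright (c) 2026. Released under Apache 2.0 license as described in the file LICENSE.
Cell pub-hodgecm, MODEL layer (construction prover mc-carch-1, gen 4), BINDER-OWNERS row 12 `C` for the CONJUGATED-plane lines k = 2, 3
at the G pins (four twist characters): the (34) twin of RUN-41 `ArchKTypeOfSlotChar`.
-/
import Summits.HodgeConjecture.HodgeCM.Model.ArchKTypeOfSlot34_2
import Summits.HodgeConjecture.HodgeCM.Model.ArchKTypeOfSlotChar_2

/-!
# Lines 2 and 3 in the literal slot at the G pins: `archKTypeOfSlotTwoG/ThreeG`

Verbatim the G-ification (`η ↦ (η₀, η₁, η₂, η₃)`, `archSideOf ↦ archSideOfChar`, `lineRepD ↦ lineRepOf`) that `ArchKTypeOfSlotChar` applied to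
`ArchKTypeOfSlot` § 5, now applied to #CA15 `ArchKTypeOfSlot34` (lines `d₂ = dW' c.D 0`, `d₃ = dW' c.D 1`, splittings `hGR₂/hGR₃`, twist
characters `η₂/η₃`, see-saw scalars `lineScalar_two/three`).  Terms `archKTypeOfSlotTwoG/ThreeG (eR) (eS) …` with inputs
{`hlevel`, `arch₀`, `harch`, `hfin`, `hsec`, `hK`, `hχ`}; `isWeaklyPDiff_archKTypeOfSlotTwoG/ThreeG` (row 14, no further hypothesis);
`isPMinusKilledAlong_archKTypeOfSlotTwo/Three_twistG` (row 15 along `twistU21 ∘ expP`, no further hypothesis).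
Nothing is cited and nothing is minted; 0 records, 0 `def … : Prop`.
-/

set_option autoImplicit false

noncomputable section

open Filter Topology Complex
open NumberField NumberField.InfinitePlace NumberField.mixedEmbedding IsDedekindDomain MeasureTheory
open scoped Matrix TensorProduct Classical SchwartzMap
open MulAction
open Literature.Geometry.ComplexHyperbolic.BallModel (U21 x₀ stabilizerEquivK21)
open Literature.NumberTheory.Automorphic.U21 (K21 matA sclD pPlus pPlus_apply)
open Literature.AlgebraicGeometry.HodgeTheory
open Literature.AlgebraicGeometry.ShimuraVarieties Literature.AlgebraicGeometry.ShimuraVarieties.BallForms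
open Literature.NumberTheory.Automorphic Literature.NumberTheory.Weil1964
open Literature.RepresentationTheory.HeisenbergGroup (polar Heisenberg symplecticGroup ofSymplectic)
open Literature.RepresentationTheory.KonnoKonno2007 Literature.RepresentationTheory.KonnoKonno2007.RealDualPair
open Literature.NumberTheory.GelbartRogawski1991 Literature.NumberTheory.GelbartRogawski1991.UnitaryDualPair
open Literature.Analysis.SegalBargmann Literature.Analysis.Distribution
open Literature.NumberTheory.Automorphic.PicardCM
open HodgeCM.Adelic HodgeCM.PerL34 HodgeCM.Model.HypCensus HodgeCM.Model.SupplyInstance HodgeCM.Model.ArchSideTerm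

namespace HodgeCM.Model
/-! ## Lines 2 and 3 of the honest S term in the literal slot `(Unit, Empty)`, G pins -/

section Slot

variable (hHD : exists_isReal_hodgeModel) (hI : hodgePQ_independent_of_hodgeModel)
  (h₁ : BallQuotientUniformised)  (h₃ : CMAbelianVarietyRealised)

variable {L : CMField} {ι₁ : L →+* ℂ} (V : HermSpace3 L ι₁) (c : SeesawCtx L)
  (hGR : (cmSplittingDatum (L : Type) finProdFinEquiv (frameD V) (frameD_real V) (frameD_ne V) (dW c.D) (dW_real c.D)
    (dW_ne c.D)).CompatibleSplitting)
  (hGR₀ : (cmSplittingDatum (L : Type) (e₁) (frameD V) (frameD_real V) (frameD_ne V) (lineVec (L : Type) (dW c.D 0))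
    (fun _ => dW_real c.D 0) (fun _ => dW_ne c.D 0)).CompatibleSplitting)
  (hGR₁ : (cmSplittingDatum (L : Type) (e₁) (frameD V) (frameD_real V) (frameD_ne V) (lineVec (L : Type) (dW c.D 1))
    (fun _ => dW_real c.D 1) (fun _ => dW_ne c.D 1)).CompatibleSplitting)
  (hGR₂ : (cmSplittingDatum (L : Type) (e₁) (frameD V) (frameD_real V) (frameD_ne V) (lineVec (L : Type) (dW' c.D 0))
    (fun _ => dW'_real c.D 0) (fun _ => dW'_ne c.D 0)).CompatibleSplitting)
  (hGR₃ : (cmSplittingDatum (L : Type) (e₁) (frameD V) (frameD_real V) (frameD_ne V) (lineVec (L : Type) (dW' c.D 1))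
    (fun _ => dW'_real c.D 1) (fun _ => dW'_ne c.D 1)).CompatibleSplitting)
  (η₀ η₁ η₂ η₃ : CMAdelic (L : Type) (frameD V) × CMAdelicOne (L : Type) →* ℂˣ)
  (hmaj : ∀ k : Fin 4, HasThetaMajorants fun (p : ↥(regimeSubgroup L V.Hm) × ↥(NumberField.relNormOneIdeles (↥(maximalRealSubfield L)) L))
      (φ : piSchwartzBruhat (↥(maximalRealSubfield L)) (Fin 3)) => lineRepOf V c.D hGR hGR₀ hGR₁ hGR₂ hGR₃ η₀ η₁ η₂ η₃ k p φ)
  (hrat : ∀ k : Fin 4, ∀ γ ∈ (V.latticeModel printFact_unitaryCompact_holds).Γ,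
      ∀ t ∈ NumberField.relNormOneRat (↥(maximalRealSubfield L)) L,
        lineRepOf V c.D hGR hGR₀ hGR₁ hGR₂ hGR₃ η₀ η₁ η₂ η₃ k (γ, t) ∈ thetaStabilizerEnd (↥(maximalRealSubfield L)) (Fin 3))
  (h₁W : (∀ j, 0 < (ι₁ (dW c.D j)).re) ∨ ∀ j, (ι₁ (dW c.D j)).re < 0)
  (A : ∀ k : Fin 4, ArchLineInput V (lineRepOf V c.D hGR hGR₀ hGR₁ hGR₂ hGR₃ η₀ η₁ η₂ η₃ k))
  (hV : IsAnisotropic L V.Hm) (N : ℕ) (Γ₀ : Level V)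
  (hlevel : ∀ δ ∈ levelImage hHD hI h₁ h₃ Γ₀ hV, ∃ x : (V.latticeModel printFact_unitaryCompact_holds).G,
    x ∈ (satLevelRegimeOf V hV Γ₀.K : Subgroup (V.latticeModel printFact_unitaryCompact_holds).G) ∧
      (archSideOfChar V c hGR hGR₀ hGR₁ hGR₂ hGR₃ η₀ η₁ η₂ η₃ hmaj hrat A).ιinf δ * x ∈ (V.latticeModel printFact_unitaryCompact_holds).Γ)
  (Φ₂ : SchwartzMap ((Fin 3 × {v : {v : InfinitePlace ↥(maximalRealSubfield L) // v.IsReal} // v ≠ cmPlace (L : Type) ι₁}) → ℝ) ℂ)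

/-! ### line 2 -/

section Two

variable
  (eR : PosIdx (cmXW (L : Type) (frameD V) (lineVec (L : Type) (dW' c.D 0)) (fun _ => dW'_real c.D 0) ι₁ (cmPlace (L : Type) ι₁)) ≃ Unit)
  (eS : NegIdx (cmXW (L : Type) (frameD V) (lineVec (L : Type) (dW' c.D 0)) (fun _ => dW'_real c.D 0) ι₁ (cmPlace (L : Type) ι₁)) ≃ Empty)
  (ℓ₀ : Module.Dual ℂ (Fin 2 → ℂ))
  (arch₀ : blockFamilyOfAt (L : Type) e₁ (frameD V) (frameD_real V) (frameD_ne V) (lineVec (L : Type) (dW' c.D 0))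
      (fun _ => dW'_real c.D 0) (fun _ => dW'_ne c.D 0) ι₁ (blockPosEquiv V) (blockNegEquiv V) eR eS (degOnePDual Empty) Φ₂ ℓ₀ =
    (A 2).Φinf)
  (harch : ∀ a : UnitaryGroup.arch (↥(maximalRealSubfield L)) L (IsCMField.complexConj L) 3 V.Hm,
    UnitaryGroup.archAt (↥(maximalRealSubfield L)) L (IsCMField.complexConj L) 3 V.Hm (UnitaryGroup.cmPlace (L : Type) ι₁)
        (NumberField.complexConj_smul_infinitePlace (L : Type) _) (IsCMField.complexConj_ne_one (L : Type)) a = 1 →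
    ∀ ℓ, ((archSideOfChar V c hGR hGR₀ hGR₁ hGR₂ hGR₃ η₀ η₁ η₂ η₃ hmaj hrat A).P 2).ω
        (HodgeCM.Adelic.regimeEquiv L V.Hm hV
          (UnitaryGroup.archToAdelic (↥(maximalRealSubfield L)) L (IsCMField.complexConj L) 3 V.Hm a), 1)
        (testFun (↥(maximalRealSubfield L)) (Fin 3)
          (blockFamilyOfAt (L : Type) e₁ (frameD V) (frameD_real V) (frameD_ne V) (lineVec (L : Type) (dW' c.D 0))
            (fun _ => dW'_real c.D 0) (fun _ => dW'_ne c.D 0) ι₁ (blockPosEquiv V) (blockNegEquiv V) eR eS (degOnePDual Empty) Φ₂ ℓ)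
          (A 2).x₀ N) =
      testFun (↥(maximalRealSubfield L)) (Fin 3)
        (blockFamilyOfAt (L : Type) e₁ (frameD V) (frameD_real V) (frameD_ne V) (lineVec (L : Type) (dW' c.D 0))
          (fun _ => dW'_real c.D 0) (fun _ => dW'_ne c.D 0) ι₁ (blockPosEquiv V) (blockNegEquiv V) eR eS (degOnePDual Empty) Φ₂ ℓ) (A 2).x₀ N)
  (hfin : ∀ kf : UnitaryGroup.finAdelic (↥(maximalRealSubfield L)) L (IsCMField.complexConj L) 3 V.Hm, kf ∈ Γ₀.K →
    ∀ Φinf : 𝓢((Fin 3 → mixedSpace (↥(maximalRealSubfield L))), ℂ),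
      ((archSideOfChar V c hGR hGR₀ hGR₁ hGR₂ hGR₃ η₀ η₁ η₂ η₃ hmaj hrat A).P 2).ω
          (HodgeCM.Adelic.regimeEquiv L V.Hm hV
            (UnitaryGroup.finAdelicToAdelic (↥(maximalRealSubfield L)) L (IsCMField.complexConj L) 3 V.Hm kf), 1)
          (testFun (↥(maximalRealSubfield L)) (Fin 3) Φinf (A 2).x₀ N) =
        testFun (↥(maximalRealSubfield L)) (Fin 3) Φinf (A 2).x₀ N)
  (hsec : ∀ u : stabilizer U21 x₀,
    cmBlockSectionAt (L : Type) (frameD V) (frameD_real V) (frameD_ne V) (lineVec (L : Type) (dW' c.D 0)) (fun _ => dW'_real c.D 0)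
        (fun _ => dW'_ne c.D 0) ι₁ (cmPlace (L : Type) ι₁) (blockPosEquiv V) (blockNegEquiv V) eR eS (u21FrameEquiv (u : U21), 1) =
      (archSectionFrameOf V u, 1))
  {ev : VacExponents}
  (hK : ∀ (kk : DPK (Fin 2) Unit Unit Empty) (Φ : SchwartzMap (DPIdx (Fin 2) Unit Unit Empty → ℝ) ℂ),
    cmBlockRepAt (L : Type) e₁ (frameD V) (frameD_real V) (frameD_ne V) (lineVec (L : Type) (dW' c.D 0)) (fun _ => dW'_real c.D 0)
        (fun _ => dW'_ne c.D 0) hGR₂ ι₁ (cmPlace (L : Type) ι₁) (blockPosEquiv V) (blockNegEquiv V) eR eS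
        (cmBlockSectionAt (L : Type) (frameD V) (frameD_real V) (frameD_ne V) (lineVec (L : Type) (dW' c.D 0)) (fun _ => dW'_real c.D 0)
          (fun _ => dW'_ne c.D 0) ι₁ (cmPlace (L : Type) ι₁) (blockPosEquiv V) (blockNegEquiv V) eR eS (κ _ _ _ _ kk)) (tensorPi Φ Φ₂) =
      tensorPi (κOp _ _ ev kk Φ) Φ₂)
  (hχ : ∀ u : stabilizer U21 x₀,
    ((lineScalar_two V c.D hGR hGR₂ hGR₃ η₂ (u : U21) : ℂˣ) : ℂ) *
        ((matA (stabilizerEquivK21.symm u)).det ^ ev.eP * sclD (stabilizerEquivK21.symm u) ^ ev.eQ) =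
      star (sclD (stabilizerEquivK21.symm u)))

/-- **ROW 12 FOR LINE 2 IN THE LITERAL SLOT** — `Φarch := blockFamilyOfAt … eR eS (degOnePDual Empty) Φ₂`; (Φ) discharged. -/
def archKTypeOfSlotTwoG :
    ArchKTypeData (thetaSpaceInputIn hHD hI h₁ h₃ (archSideOfChar V c hGR hGR₀ hGR₁ hGR₂ hGR₃ η₀ η₁ η₂ η₃ hmaj hrat A) hV) 2 N :=
  archKTypeOf hHD hI h₁ h₃ (archSideOfChar V c hGR hGR₀ hGR₁ hGR₂ hGR₃ η₀ η₁ η₂ η₃ hmaj hrat A) hV 2 N Γ₀ Γ₀.K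
    (satLevelRegimeOf_le_archFinOf V hV Γ₀.K) hlevel (fun _ hg => hg)
    (lineOmega_two V c.D hGR hGR₂ hGR₃ η₂)
    (fun g => lineRepOf_two_archInfOf_eq V c.D hGR hGR₀ hGR₁ hGR₂ hGR₃ η₀ η₁ η₂
      η₃ hV g)
    (blockFamilyOfAt (L : Type) e₁ (frameD V) (frameD_real V) (frameD_ne V) (lineVec (L : Type) (dW' c.D 0)) (fun _ => dW'_real c.D 0)
      (fun _ => dW'_ne c.D 0) ι₁ (blockPosEquiv V) (blockNegEquiv V) eR eS (degOnePDual Empty) Φ₂)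
    ℓ₀ arch₀
    (satLevel_fix_of_arch_of_fin (archSideOfChar V c hGR hGR₀ hGR₁ hGR₂ hGR₃ η₀ η₁ η₂ η₃ hmaj hrat A) hV 2 N Γ₀.K
      (fun ℓ => blockFamilyOfAt (L : Type) e₁ (frameD V) (frameD_real V) (frameD_ne V) (lineVec (L : Type) (dW' c.D 0))
        (fun _ => dW'_real c.D 0) (fun _ => dW'_ne c.D 0) ι₁ (blockPosEquiv V) (blockNegEquiv V) eR eS (degOnePDual Empty) Φ₂ ℓ)
      harch hfin)
    (smulPull_blockFamilyOfAt_harm V e₁ (lineVec (L : Type) (dW' c.D 0)) (fun _ => dW'_real c.D 0) (fun _ => dW'_ne c.D 0) hGR₂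
      (lineScalar_two V c.D hGR hGR₂ hGR₃ η₂) eR eS (degOnePDual Empty) Φ₂ hsec hK
      (unitaryOpPi_dualPairι_degOnePDual Empty) hχ)

/-- `ωinf` of the slot term is `lineOmega_two` (#CA1v4 `archKTypeOf_ωinf_apply`). -/
theorem archKTypeOfSlotTwo_ωinf_applyG (g : U21) (Φ : 𝓢((Fin 3 → mixedSpace (↥(maximalRealSubfield L))), ℂ)) :
    (archKTypeOfSlotTwoG hHD hI h₁ h₃ V c hGR hGR₀ hGR₁ hGR₂ hGR₃ η₀ η₁ η₂ η₃ hmaj hrat A hV N Γ₀ hlevel Φ₂ eR eS ℓ₀ arch₀ harch hfin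
        hsec hK hχ).ωinf g Φ = lineOmega_two V c.D hGR hGR₂ hGR₃ η₂ g Φ :=
  archKTypeOf_ωinf_apply hHD hI h₁ h₃ _ hV 2 N Γ₀ Γ₀.K _ hlevel _ _ _ _ ℓ₀ arch₀ _ _ g Φ

/-- `Φarch` of the slot term (rfl). -/
theorem archKTypeOfSlotTwo_ΦarchG :
    (archKTypeOfSlotTwoG hHD hI h₁ h₃ V c hGR hGR₀ hGR₁ hGR₂ hGR₃ η₀ η₁ η₂ η₃ hmaj hrat A hV N Γ₀ hlevel Φ₂ eR eS ℓ₀ arch₀ harch hfin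
        hsec hK hχ).Φarch =
      blockFamilyOfAt (L : Type) e₁ (frameD V) (frameD_real V) (frameD_ne V) (lineVec (L : Type) (dW' c.D 0)) (fun _ => dW'_real c.D 0)
        (fun _ => dW'_ne c.D 0) ι₁ (blockPosEquiv V) (blockNegEquiv V) eR eS (degOnePDual Empty) Φ₂ :=
  rfl

/-- `hωA` in the `…At` frame: `lineOmega_two (twistU21 (expP b)) = cmArchWeilRep (cmBlockSectionAt … (u21FrameEquiv (expP b), 1))`. -/
theorem lineOmega_two_twistU21_expP_AtG (b : Fin 2 → ℂ) :
    lineOmega_two V c.D hGR hGR₂ hGR₃ η₂ (twistU21 L ι₁ (BallForms.expP b)) =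
      cmArchWeilRep (L : Type) e₁ (frameD V) (frameD_real V) (frameD_ne V) (lineVec (L : Type) (dW' c.D 0))
        (fun _ => dW'_real c.D 0) (fun _ => dW'_ne c.D 0) hGR₂
        (cmBlockSectionAt (L : Type) (frameD V) (frameD_real V) (frameD_ne V) (lineVec (L : Type) (dW' c.D 0))
          (fun _ => dW'_real c.D 0) (fun _ => dW'_ne c.D 0) ι₁ (cmPlace (L : Type) ι₁) (blockPosEquiv V) (blockNegEquiv V) eR eS
          (((u21FrameEquiv (BallForms.expP b) : UForm (Fin 2) Unit), (1 : UForm Unit Empty)) : Ginf (Fin 2) Unit Unit Empty)) := by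
  rw [cmBlockSectionAt_inl_one, lineOmega_two_twistU21_expP]

/-- the intertwining identity `hτ` of BRICK 4 for the slot term along `twistU21 ∘ expP`, `τ := F⁻¹`. -/
theorem archKTypeOfSlotTwo_hτG (b : Fin 2 → ℂ)
    (x : SchwartzMap (DPIdx (Fin 2) Unit Unit Empty ⊕
      (Fin 3 × {w : {w : InfinitePlace ↥(maximalRealSubfield L) // w.IsReal} // w ≠ cmPlace (L : Type) ι₁}) → ℝ) ℂ) :
    (archKTypeOfSlotTwoG hHD hI h₁ h₃ V c hGR hGR₀ hGR₁ hGR₂ hGR₃ η₀ η₁ η₂ η₃ hmaj hrat A hV N Γ₀ hlevel Φ₂ eR eS ℓ₀ arch₀ harch hfin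
        hsec hK hχ).ωinf (twistU21 L ι₁ (BallForms.expP b))
        (((cmBlockFrameAt (L : Type) e₁ (frameD V) (frameD_real V) (frameD_ne V) (lineVec (L : Type) (dW' c.D 0))
          (fun _ => dW'_real c.D 0) (fun _ => dW'_ne c.D 0) ι₁ (cmPlace (L : Type) ι₁) (blockPosEquiv V) (blockNegEquiv V) eR eS).symm :
            _ ≃L[ℂ] _) x) =
      ((cmBlockFrameAt (L : Type) e₁ (frameD V) (frameD_real V) (frameD_ne V) (lineVec (L : Type) (dW' c.D 0))
          (fun _ => dW'_real c.D 0) (fun _ => dW'_ne c.D 0) ι₁ (cmPlace (L : Type) ι₁) (blockPosEquiv V) (blockNegEquiv V) eR eS).symm :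
            _ ≃L[ℂ] _)
        (cmBlockRepAt (L : Type) e₁ (frameD V) (frameD_real V) (frameD_ne V) (lineVec (L : Type) (dW' c.D 0)) (fun _ => dW'_real c.D 0)
          (fun _ => dW'_ne c.D 0) hGR₂ ι₁ (cmPlace (L : Type) ι₁) (blockPosEquiv V) (blockNegEquiv V) eR eS
          (cmBlockSectionAt (L : Type) (frameD V) (frameD_real V) (frameD_ne V) (lineVec (L : Type) (dW' c.D 0))
            (fun _ => dW'_real c.D 0) (fun _ => dW'_ne c.D 0) ι₁ (cmPlace (L : Type) ι₁) (blockPosEquiv V) (blockNegEquiv V) eR eS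
            (((u21FrameEquiv (BallForms.expP b) : UForm (Fin 2) Unit), (1 : UForm Unit Empty)) : Ginf (Fin 2) Unit Unit Empty)) x) := by
  rw [archKTypeOfSlotTwo_ωinf_applyG, lineOmega_two_twistU21_expP_AtG, cmArchWeilRep_cmBlockFrameAt_symm]

set_option backward.isDefEq.respectTransparency false in
/-- **ROW 14 FOR LINE 2 IN THE LITERAL SLOT — NO HYPOTHESIS BEYOND THE TERM'S INPUTS.** -/
theorem isWeaklyPDiff_archKTypeOfSlotTwoG :
    (archKTypeOfSlotTwoG hHD hI h₁ h₃ V c hGR hGR₀ hGR₁ hGR₂ hGR₃ η₀ η₁ η₂ η₃ hmaj hrat A hV N Γ₀ hlevel Φ₂ eR eS ℓ₀ arch₀ harch hfin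
        hsec hK hχ).IsWeaklyPDiff BallForms.expP := by
  obtain ⟨ω₁, hW₁, hc₁⟩ := exists_isArchWeilDatum_lineSlot (R := Unit) (S := Empty)
  obtain ⟨ev₁, hvac₁⟩ := (junction (Fin 2) Unit Unit Empty).exists_vacExponents hW₁
  refine (ArchKTypeData.isWeaklyPDiff_twistVec_iff
    (X := thetaSpaceInputIn hHD hI h₁ h₃ (archSideOfChar V c hGR hGR₀ hGR₁ hGR₂ hGR₃ η₀ η₁ η₂ η₃ hmaj hrat A) hV) _ BallForms.expP).1 ?_
  rw [← twistU21_comp_expP]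
  exact ArchKTypeData.isWeaklyPDiff_of_blockPair
    (X := thetaSpaceInputIn hHD hI h₁ h₃ (archSideOfChar V c hGR hGR₀ hGR₁ hGR₂ hGR₃ η₀ η₁ η₂ η₃ hmaj hrat A) hV) _
    (isArchWeilDatum_cmBlockAt (L : Type) e₁ (frameD V) (frameD_real V) (frameD_ne V) (lineVec (L : Type) (dW' c.D 0))
      (fun _ => dW'_real c.D 0) (fun _ => dW'_ne c.D 0) hGR₂ ι₁ (cmPlace (L : Type) ι₁) (blockPosEquiv V) (blockNegEquiv V) eR eS
      (frameD_sign_ι₁' V) (line_hs₁W_of_real (dW'_real c.D 0) (dW'_ne c.D 0)) (frameD_sign_of_ne V) (fun τ hτ => line_hsW (dW' c.D 0) τ hτ))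
    (continuous_cmBlockRepAt (L : Type) e₁ (frameD V) (frameD_real V) (frameD_ne V) (lineVec (L : Type) (dW' c.D 0))
      (fun _ => dW'_real c.D 0) (fun _ => dW'_ne c.D 0) hGR₂ ι₁ (cmPlace (L : Type) ι₁) (blockPosEquiv V) (blockNegEquiv V) eR eS)
    hW₁ hc₁ hvac₁
    (cmBlockSectionAt (L : Type) (frameD V) (frameD_real V) (frameD_ne V) (lineVec (L : Type) (dW' c.D 0)) (fun _ => dW'_real c.D 0)
      (fun _ => dW'_ne c.D 0) ι₁ (cmPlace (L : Type) ι₁) (blockPosEquiv V) (blockNegEquiv V) eR eS)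
    (continuous_cmBlockSectionAt (L : Type) (frameD V) (frameD_real V) (frameD_ne V) (lineVec (L : Type) (dW' c.D 0))
      (fun _ => dW'_real c.D 0) (fun _ => dW'_ne c.D 0) ι₁ (cmPlace (L : Type) ι₁) (blockPosEquiv V) (blockNegEquiv V) eR eS)
    (coe_cmBlockPhaseHomAt_cmBlockSectionAt (L : Type) e₁ (frameD V) (frameD_real V) (frameD_ne V) (lineVec (L : Type) (dW' c.D 0))
      (fun _ => dW'_real c.D 0) (fun _ => dW'_ne c.D 0) ι₁ (cmPlace (L : Type) ι₁) (blockPosEquiv V) (blockNegEquiv V) eR eS)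
    (fun b => twistU21 L ι₁ (BallForms.expP b))
    ((cmBlockFrameAt (L : Type) e₁ (frameD V) (frameD_real V) (frameD_ne V) (lineVec (L : Type) (dW' c.D 0)) (fun _ => dW'_real c.D 0)
      (fun _ => dW'_ne c.D 0) ι₁ (cmPlace (L : Type) ι₁) (blockPosEquiv V) (blockNegEquiv V) eR eS).symm.toContinuousLinearMap)
    (archKTypeOfSlotTwo_hτG hHD hI h₁ h₃ V c hGR hGR₀ hGR₁ hGR₂ hGR₃ η₀ η₁ η₂ η₃ hmaj hrat A hV N Γ₀ hlevel Φ₂ eR eS ℓ₀ arch₀ harch hfin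
      hsec hK hχ)
    Φ₂ (degOnePDual Empty) (fun _ => rfl)

set_option backward.isDefEq.respectTransparency false in
/-- **ROW 15 FOR LINE 2 IN THE LITERAL SLOT ALONG `twistU21 ∘ expP` — NO HYPOTHESIS BEYOND THE TERM'S INPUTS** (`hf` = § 4);
the `expP` form is the (TWIST-2) item. -/
theorem isPMinusKilledAlong_archKTypeOfSlotTwo_twistG (p : Fin 2) :
    (archKTypeOfSlotTwoG hHD hI h₁ h₃ V c hGR hGR₀ hGR₁ hGR₂ hGR₃ η₀ η₁ η₂ η₃ hmaj hrat A hV N Γ₀ hlevel Φ₂ eR eS ℓ₀ arch₀ harch hfin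
        hsec hK hχ).IsPMinusKilledAlong (fun b => twistU21 L ι₁ (BallForms.expP b)) (-Complex.I • (Pi.single p 1 : Fin 2 → ℂ)) := by
  obtain ⟨ω₁, hW₁, hc₁⟩ := exists_isArchWeilDatum_lineSlot (R := Unit) (S := Empty)
  exact ArchKTypeData.isPMinusKilledAlong_of_blockPair
    (X := thetaSpaceInputIn hHD hI h₁ h₃ (archSideOfChar V c hGR hGR₀ hGR₁ hGR₂ hGR₃ η₀ η₁ η₂ η₃ hmaj hrat A) hV) _
    (isArchWeilDatum_cmBlockAt (L : Type) e₁ (frameD V) (frameD_real V) (frameD_ne V) (lineVec (L : Type) (dW' c.D 0))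
      (fun _ => dW'_real c.D 0) (fun _ => dW'_ne c.D 0) hGR₂ ι₁ (cmPlace (L : Type) ι₁) (blockPosEquiv V) (blockNegEquiv V) eR eS
      (frameD_sign_ι₁' V) (line_hs₁W_of_real (dW'_real c.D 0) (dW'_ne c.D 0)) (frameD_sign_of_ne V) (fun τ hτ => line_hsW (dW' c.D 0) τ hτ))
    (continuous_cmBlockRepAt (L : Type) e₁ (frameD V) (frameD_real V) (frameD_ne V) (lineVec (L : Type) (dW' c.D 0))
      (fun _ => dW'_real c.D 0) (fun _ => dW'_ne c.D 0) hGR₂ ι₁ (cmPlace (L : Type) ι₁) (blockPosEquiv V) (blockNegEquiv V) eR eS)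
    hW₁ hc₁
    (cmBlockSectionAt (L : Type) (frameD V) (frameD_real V) (frameD_ne V) (lineVec (L : Type) (dW' c.D 0)) (fun _ => dW'_real c.D 0)
      (fun _ => dW'_ne c.D 0) ι₁ (cmPlace (L : Type) ι₁) (blockPosEquiv V) (blockNegEquiv V) eR eS)
    (continuous_cmBlockSectionAt (L : Type) (frameD V) (frameD_real V) (frameD_ne V) (lineVec (L : Type) (dW' c.D 0))
      (fun _ => dW'_real c.D 0) (fun _ => dW'_ne c.D 0) ι₁ (cmPlace (L : Type) ι₁) (blockPosEquiv V) (blockNegEquiv V) eR eS)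
    (coe_cmBlockPhaseHomAt_cmBlockSectionAt (L : Type) e₁ (frameD V) (frameD_real V) (frameD_ne V) (lineVec (L : Type) (dW' c.D 0))
      (fun _ => dW'_real c.D 0) (fun _ => dW'_ne c.D 0) ι₁ (cmPlace (L : Type) ι₁) (blockPosEquiv V) (blockNegEquiv V) eR eS)
    (fun b => twistU21 L ι₁ (BallForms.expP b))
    ((cmBlockFrameAt (L : Type) e₁ (frameD V) (frameD_real V) (frameD_ne V) (lineVec (L : Type) (dW' c.D 0)) (fun _ => dW'_real c.D 0)
      (fun _ => dW'_ne c.D 0) ι₁ (cmPlace (L : Type) ι₁) (blockPosEquiv V) (blockNegEquiv V) eR eS).symm.toContinuousLinearMap)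
    (archKTypeOfSlotTwo_hτG hHD hI h₁ h₃ V c hGR hGR₀ hGR₁ hGR₂ hGR₃ η₀ η₁ η₂ η₃ hmaj hrat A hV N Γ₀ hlevel Φ₂ eR eS ℓ₀ arch₀ harch hfin
      hsec hK hχ)
    Φ₂ (degOnePDual Empty) (fun _ => rfl) (hypOpGen_add_I_smul_rotBoostGen_degOnePDual Empty) p

end Two

/-! ### line 3 -/

section Three

variable
  (eR : PosIdx (cmXW (L : Type) (frameD V) (lineVec (L : Type) (dW' c.D 1)) (fun _ => dW'_real c.D 1) ι₁ (cmPlace (L : Type) ι₁)) ≃ Unit)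
  (eS : NegIdx (cmXW (L : Type) (frameD V) (lineVec (L : Type) (dW' c.D 1)) (fun _ => dW'_real c.D 1) ι₁ (cmPlace (L : Type) ι₁)) ≃ Empty)
  (ℓ₀ : Module.Dual ℂ (Fin 2 → ℂ))
  (arch₀ : blockFamilyOfAt (L : Type) e₁ (frameD V) (frameD_real V) (frameD_ne V) (lineVec (L : Type) (dW' c.D 1))
      (fun _ => dW'_real c.D 1) (fun _ => dW'_ne c.D 1) ι₁ (blockPosEquiv V) (blockNegEquiv V) eR eS (degOnePDual Empty) Φ₂ ℓ₀ =
    (A 3).Φinf)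
  (harch : ∀ a : UnitaryGroup.arch (↥(maximalRealSubfield L)) L (IsCMField.complexConj L) 3 V.Hm,
    UnitaryGroup.archAt (↥(maximalRealSubfield L)) L (IsCMField.complexConj L) 3 V.Hm (UnitaryGroup.cmPlace (L : Type) ι₁)
        (NumberField.complexConj_smul_infinitePlace (L : Type) _) (IsCMField.complexConj_ne_one (L : Type)) a = 1 →
    ∀ ℓ, ((archSideOfChar V c hGR hGR₀ hGR₁ hGR₂ hGR₃ η₀ η₁ η₂ η₃ hmaj hrat A).P 3).ω
        (HodgeCM.Adelic.regimeEquiv L V.Hm hV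
          (UnitaryGroup.archToAdelic (↥(maximalRealSubfield L)) L (IsCMField.complexConj L) 3 V.Hm a), 1)
        (testFun (↥(maximalRealSubfield L)) (Fin 3)
          (blockFamilyOfAt (L : Type) e₁ (frameD V) (frameD_real V) (frameD_ne V) (lineVec (L : Type) (dW' c.D 1))
            (fun _ => dW'_real c.D 1) (fun _ => dW'_ne c.D 1) ι₁ (blockPosEquiv V) (blockNegEquiv V) eR eS (degOnePDual Empty) Φ₂ ℓ)
          (A 3).x₀ N) =
      testFun (↥(maximalRealSubfield L)) (Fin 3)
        (blockFamilyOfAt (L : Type) e₁ (frameD V) (frameD_real V) (frameD_ne V) (lineVec (L : Type) (dW' c.D 1))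
          (fun _ => dW'_real c.D 1) (fun _ => dW'_ne c.D 1) ι₁ (blockPosEquiv V) (blockNegEquiv V) eR eS (degOnePDual Empty) Φ₂ ℓ) (A 3).x₀ N)
  (hfin : ∀ kf : UnitaryGroup.finAdelic (↥(maximalRealSubfield L)) L (IsCMField.complexConj L) 3 V.Hm, kf ∈ Γ₀.K →
    ∀ Φinf : 𝓢((Fin 3 → mixedSpace (↥(maximalRealSubfield L))), ℂ),
      ((archSideOfChar V c hGR hGR₀ hGR₁ hGR₂ hGR₃ η₀ η₁ η₂ η₃ hmaj hrat A).P 3).ω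
          (HodgeCM.Adelic.regimeEquiv L V.Hm hV
            (UnitaryGroup.finAdelicToAdelic (↥(maximalRealSubfield L)) L (IsCMField.complexConj L) 3 V.Hm kf), 1)
          (testFun (↥(maximalRealSubfield L)) (Fin 3) Φinf (A 3).x₀ N) =
        testFun (↥(maximalRealSubfield L)) (Fin 3) Φinf (A 3).x₀ N)
  (hsec : ∀ u : stabilizer U21 x₀,
    cmBlockSectionAt (L : Type) (frameD V) (frameD_real V) (frameD_ne V) (lineVec (L : Type) (dW' c.D 1)) (fun _ => dW'_real c.D 1)
        (fun _ => dW'_ne c.D 1) ι₁ (cmPlace (L : Type) ι₁) (blockPosEquiv V) (blockNegEquiv V) eR eS (u21FrameEquiv (u : U21), 1) =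
      (archSectionFrameOf V u, 1))
  {ev : VacExponents}
  (hK : ∀ (kk : DPK (Fin 2) Unit Unit Empty) (Φ : SchwartzMap (DPIdx (Fin 2) Unit Unit Empty → ℝ) ℂ),
    cmBlockRepAt (L : Type) e₁ (frameD V) (frameD_real V) (frameD_ne V) (lineVec (L : Type) (dW' c.D 1)) (fun _ => dW'_real c.D 1)
        (fun _ => dW'_ne c.D 1) hGR₃ ι₁ (cmPlace (L : Type) ι₁) (blockPosEquiv V) (blockNegEquiv V) eR eS
        (cmBlockSectionAt (L : Type) (frameD V) (frameD_real V) (frameD_ne V) (lineVec (L : Type) (dW' c.D 1)) (fun _ => dW'_real c.D 1)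
          (fun _ => dW'_ne c.D 1) ι₁ (cmPlace (L : Type) ι₁) (blockPosEquiv V) (blockNegEquiv V) eR eS (κ _ _ _ _ kk)) (tensorPi Φ Φ₂) =
      tensorPi (κOp _ _ ev kk Φ) Φ₂)
  (hχ : ∀ u : stabilizer U21 x₀,
    ((lineScalar_three V c.D hGR hGR₂ hGR₃ η₃ (u : U21) : ℂˣ) : ℂ) *
        ((matA (stabilizerEquivK21.symm u)).det ^ ev.eP * sclD (stabilizerEquivK21.symm u) ^ ev.eQ) =
      star (sclD (stabilizerEquivK21.symm u)))

/-- **ROW 12 FOR LINE 3 IN THE LITERAL SLOT** — `Φarch := blockFamilyOfAt … eR eS (degOnePDual Empty) Φ₂`; (Φ) discharged. -/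
def archKTypeOfSlotThreeG :
    ArchKTypeData (thetaSpaceInputIn hHD hI h₁ h₃ (archSideOfChar V c hGR hGR₀ hGR₁ hGR₂ hGR₃ η₀ η₁ η₂ η₃ hmaj hrat A) hV) 3 N :=
  archKTypeOf hHD hI h₁ h₃ (archSideOfChar V c hGR hGR₀ hGR₁ hGR₂ hGR₃ η₀ η₁ η₂ η₃ hmaj hrat A) hV 3 N Γ₀ Γ₀.K
    (satLevelRegimeOf_le_archFinOf V hV Γ₀.K) hlevel (fun _ hg => hg)
    (lineOmega_three V c.D hGR hGR₂ hGR₃ η₃)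
    (fun g => lineRepOf_three_archInfOf_eq V c.D hGR hGR₀ hGR₁ hGR₂ hGR₃ η₀ η₁ η₂
      η₃ hV g)
    (blockFamilyOfAt (L : Type) e₁ (frameD V) (frameD_real V) (frameD_ne V) (lineVec (L : Type) (dW' c.D 1)) (fun _ => dW'_real c.D 1)
      (fun _ => dW'_ne c.D 1) ι₁ (blockPosEquiv V) (blockNegEquiv V) eR eS (degOnePDual Empty) Φ₂)
    ℓ₀ arch₀
    (satLevel_fix_of_arch_of_fin (archSideOfChar V c hGR hGR₀ hGR₁ hGR₂ hGR₃ η₀ η₁ η₂ η₃ hmaj hrat A) hV 3 N Γ₀.K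
      (fun ℓ => blockFamilyOfAt (L : Type) e₁ (frameD V) (frameD_real V) (frameD_ne V) (lineVec (L : Type) (dW' c.D 1))
        (fun _ => dW'_real c.D 1) (fun _ => dW'_ne c.D 1) ι₁ (blockPosEquiv V) (blockNegEquiv V) eR eS (degOnePDual Empty) Φ₂ ℓ)
      harch hfin)
    (smulPull_blockFamilyOfAt_harm V e₁ (lineVec (L : Type) (dW' c.D 1)) (fun _ => dW'_real c.D 1) (fun _ => dW'_ne c.D 1) hGR₃
      (lineScalar_three V c.D hGR hGR₂ hGR₃ η₃) eR eS (degOnePDual Empty) Φ₂ hsec hK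
      (unitaryOpPi_dualPairι_degOnePDual Empty) hχ)

/-- `ωinf` of the slot term is `lineOmega_three` (#CA1v4 `archKTypeOf_ωinf_apply`). -/
theorem archKTypeOfSlotThree_ωinf_applyG (g : U21) (Φ : 𝓢((Fin 3 → mixedSpace (↥(maximalRealSubfield L))), ℂ)) :
    (archKTypeOfSlotThreeG hHD hI h₁ h₃ V c hGR hGR₀ hGR₁ hGR₂ hGR₃ η₀ η₁ η₂ η₃ hmaj hrat A hV N Γ₀ hlevel Φ₂ eR eS ℓ₀ arch₀ harch hfin
        hsec hK hχ).ωinf g Φ = lineOmega_three V c.D hGR hGR₂ hGR₃ η₃ g Φ :=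
  archKTypeOf_ωinf_apply hHD hI h₁ h₃ _ hV 3 N Γ₀ Γ₀.K _ hlevel _ _ _ _ ℓ₀ arch₀ _ _ g Φ

/-- `Φarch` of the slot term (rfl). -/
theorem archKTypeOfSlotThree_ΦarchG :
    (archKTypeOfSlotThreeG hHD hI h₁ h₃ V c hGR hGR₀ hGR₁ hGR₂ hGR₃ η₀ η₁ η₂ η₃ hmaj hrat A hV N Γ₀ hlevel Φ₂ eR eS ℓ₀ arch₀ harch hfin
        hsec hK hχ).Φarch =
      blockFamilyOfAt (L : Type) e₁ (frameD V) (frameD_real V) (frameD_ne V) (lineVec (L : Type) (dW' c.D 1)) (fun _ => dW'_real c.D 1)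
        (fun _ => dW'_ne c.D 1) ι₁ (blockPosEquiv V) (blockNegEquiv V) eR eS (degOnePDual Empty) Φ₂ :=
  rfl

/-- `hωA` in the `…At` frame: `lineOmega_three (twistU21 (expP b)) = cmArchWeilRep (cmBlockSectionAt … (u21FrameEquiv (expP b), 1))`. -/
theorem lineOmega_three_twistU21_expP_AtG (b : Fin 2 → ℂ) :
    lineOmega_three V c.D hGR hGR₂ hGR₃ η₃ (twistU21 L ι₁ (BallForms.expP b)) =
      cmArchWeilRep (L : Type) e₁ (frameD V) (frameD_real V) (frameD_ne V) (lineVec (L : Type) (dW' c.D 1))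
        (fun _ => dW'_real c.D 1) (fun _ => dW'_ne c.D 1) hGR₃
        (cmBlockSectionAt (L : Type) (frameD V) (frameD_real V) (frameD_ne V) (lineVec (L : Type) (dW' c.D 1))
          (fun _ => dW'_real c.D 1) (fun _ => dW'_ne c.D 1) ι₁ (cmPlace (L : Type) ι₁) (blockPosEquiv V) (blockNegEquiv V) eR eS
          (((u21FrameEquiv (BallForms.expP b) : UForm (Fin 2) Unit), (1 : UForm Unit Empty)) : Ginf (Fin 2) Unit Unit Empty)) := by
  rw [cmBlockSectionAt_inl_one, lineOmega_three_twistU21_expP]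

/-- the intertwining identity `hτ` of BRICK 4 for the slot term along `twistU21 ∘ expP`, `τ := F⁻¹`. -/
theorem archKTypeOfSlotThree_hτG (b : Fin 2 → ℂ)
    (x : SchwartzMap (DPIdx (Fin 2) Unit Unit Empty ⊕
      (Fin 3 × {w : {w : InfinitePlace ↥(maximalRealSubfield L) // w.IsReal} // w ≠ cmPlace (L : Type) ι₁}) → ℝ) ℂ) :
    (archKTypeOfSlotThreeG hHD hI h₁ h₃ V c hGR hGR₀ hGR₁ hGR₂ hGR₃ η₀ η₁ η₂ η₃ hmaj hrat A hV N Γ₀ hlevel Φ₂ eR eS ℓ₀ arch₀ harch hfin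
        hsec hK hχ).ωinf (twistU21 L ι₁ (BallForms.expP b))
        (((cmBlockFrameAt (L : Type) e₁ (frameD V) (frameD_real V) (frameD_ne V) (lineVec (L : Type) (dW' c.D 1))
          (fun _ => dW'_real c.D 1) (fun _ => dW'_ne c.D 1) ι₁ (cmPlace (L : Type) ι₁) (blockPosEquiv V) (blockNegEquiv V) eR eS).symm :
            _ ≃L[ℂ] _) x) =
      ((cmBlockFrameAt (L : Type) e₁ (frameD V) (frameD_real V) (frameD_ne V) (lineVec (L : Type) (dW' c.D 1))
          (fun _ => dW'_real c.D 1) (fun _ => dW'_ne c.D 1) ι₁ (cmPlace (L : Type) ι₁) (blockPosEquiv V) (blockNegEquiv V) eR eS).symm :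
            _ ≃L[ℂ] _)
        (cmBlockRepAt (L : Type) e₁ (frameD V) (frameD_real V) (frameD_ne V) (lineVec (L : Type) (dW' c.D 1)) (fun _ => dW'_real c.D 1)
          (fun _ => dW'_ne c.D 1) hGR₃ ι₁ (cmPlace (L : Type) ι₁) (blockPosEquiv V) (blockNegEquiv V) eR eS
          (cmBlockSectionAt (L : Type) (frameD V) (frameD_real V) (frameD_ne V) (lineVec (L : Type) (dW' c.D 1))
            (fun _ => dW'_real c.D 1) (fun _ => dW'_ne c.D 1) ι₁ (cmPlace (L : Type) ι₁) (blockPosEquiv V) (blockNegEquiv V) eR eS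
            (((u21FrameEquiv (BallForms.expP b) : UForm (Fin 2) Unit), (1 : UForm Unit Empty)) : Ginf (Fin 2) Unit Unit Empty)) x) := by
  rw [archKTypeOfSlotThree_ωinf_applyG, lineOmega_three_twistU21_expP_AtG, cmArchWeilRep_cmBlockFrameAt_symm]

set_option backward.isDefEq.respectTransparency false in
/-- **ROW 14 FOR LINE 3 IN THE LITERAL SLOT — NO HYPOTHESIS BEYOND THE TERM'S INPUTS.** -/
theorem isWeaklyPDiff_archKTypeOfSlotThreeG :
    (archKTypeOfSlotThreeG hHD hI h₁ h₃ V c hGR hGR₀ hGR₁ hGR₂ hGR₃ η₀ η₁ η₂ η₃ hmaj hrat A hV N Γ₀ hlevel Φ₂ eR eS ℓ₀ arch₀ harch hfin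
        hsec hK hχ).IsWeaklyPDiff BallForms.expP := by
  obtain ⟨ω₁, hW₁, hc₁⟩ := exists_isArchWeilDatum_lineSlot (R := Unit) (S := Empty)
  obtain ⟨ev₁, hvac₁⟩ := (junction (Fin 2) Unit Unit Empty).exists_vacExponents hW₁
  refine (ArchKTypeData.isWeaklyPDiff_twistVec_iff
    (X := thetaSpaceInputIn hHD hI h₁ h₃ (archSideOfChar V c hGR hGR₀ hGR₁ hGR₂ hGR₃ η₀ η₁ η₂ η₃ hmaj hrat A) hV) _ BallForms.expP).1 ?_
  rw [← twistU21_comp_expP]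
  exact ArchKTypeData.isWeaklyPDiff_of_blockPair
    (X := thetaSpaceInputIn hHD hI h₁ h₃ (archSideOfChar V c hGR hGR₀ hGR₁ hGR₂ hGR₃ η₀ η₁ η₂ η₃ hmaj hrat A) hV) _
    (isArchWeilDatum_cmBlockAt (L : Type) e₁ (frameD V) (frameD_real V) (frameD_ne V) (lineVec (L : Type) (dW' c.D 1))
      (fun _ => dW'_real c.D 1) (fun _ => dW'_ne c.D 1) hGR₃ ι₁ (cmPlace (L : Type) ι₁) (blockPosEquiv V) (blockNegEquiv V) eR eS
      (frameD_sign_ι₁' V) (line_hs₁W_of_real (dW'_real c.D 1) (dW'_ne c.D 1)) (frameD_sign_of_ne V) (fun τ hτ => line_hsW (dW' c.D 1) τ hτ))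
    (continuous_cmBlockRepAt (L : Type) e₁ (frameD V) (frameD_real V) (frameD_ne V) (lineVec (L : Type) (dW' c.D 1))
      (fun _ => dW'_real c.D 1) (fun _ => dW'_ne c.D 1) hGR₃ ι₁ (cmPlace (L : Type) ι₁) (blockPosEquiv V) (blockNegEquiv V) eR eS)
    hW₁ hc₁ hvac₁
    (cmBlockSectionAt (L : Type) (frameD V) (frameD_real V) (frameD_ne V) (lineVec (L : Type) (dW' c.D 1)) (fun _ => dW'_real c.D 1)
      (fun _ => dW'_ne c.D 1) ι₁ (cmPlace (L : Type) ι₁) (blockPosEquiv V) (blockNegEquiv V) eR eS)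
    (continuous_cmBlockSectionAt (L : Type) (frameD V) (frameD_real V) (frameD_ne V) (lineVec (L : Type) (dW' c.D 1))
      (fun _ => dW'_real c.D 1) (fun _ => dW'_ne c.D 1) ι₁ (cmPlace (L : Type) ι₁) (blockPosEquiv V) (blockNegEquiv V) eR eS)
    (coe_cmBlockPhaseHomAt_cmBlockSectionAt (L : Type) e₁ (frameD V) (frameD_real V) (frameD_ne V) (lineVec (L : Type) (dW' c.D 1))
      (fun _ => dW'_real c.D 1) (fun _ => dW'_ne c.D 1) ι₁ (cmPlace (L : Type) ι₁) (blockPosEquiv V) (blockNegEquiv V) eR eS)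
    (fun b => twistU21 L ι₁ (BallForms.expP b))
    ((cmBlockFrameAt (L : Type) e₁ (frameD V) (frameD_real V) (frameD_ne V) (lineVec (L : Type) (dW' c.D 1)) (fun _ => dW'_real c.D 1)
      (fun _ => dW'_ne c.D 1) ι₁ (cmPlace (L : Type) ι₁) (blockPosEquiv V) (blockNegEquiv V) eR eS).symm.toContinuousLinearMap)
    (archKTypeOfSlotThree_hτG hHD hI h₁ h₃ V c hGR hGR₀ hGR₁ hGR₂ hGR₃ η₀ η₁ η₂ η₃ hmaj hrat A hV N Γ₀ hlevel Φ₂ eR eS ℓ₀ arch₀ harch hfin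
      hsec hK hχ)
    Φ₂ (degOnePDual Empty) (fun _ => rfl)


-- port_pkg: scope closed for this part
end Three
end Slot
end HodgeCM.Model
end
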